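import Mathlib
import Summits.Parity.BatemanHorn.Theorems.IsogenyRedeiTypeIMainTermCounting
import Summits.Parity.BatemanHorn.Theorems.IsogenyRedeiTypeIMainTermWeights

/-!
# Crux `PolyMobiusTail` (stmt-Parity-0870), line `Sketch` (natural form): stub `stub_kernel_sum_eq`

Pure bookkeeping. The line's kernel `V_S(y)` — the truncated signed singular sum over the
hyperbolic box `[1,⌊y⌋]^k ∩ {∏ dᵢ ≤ y}` with weight
`(∏ μ(dᵢ)) (∏_{i∉S} log dᵢ) · #{n < ∏ dᵢ : dᵢ ∣ fᵢ(n) ∀ i}/∏ dᵢ` — is the partial sum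
`Σ_{m ≤ y} [ε_{univ∖S}] 𝒶(m)` of a component of the Type-I-main-term generating function
`𝒶(m) = Σ_{d₁⋯d_k = m} G(d) ∏ᵢ (μ(dᵢ) + εᵢ μ(dᵢ) log dᵢ) ∈ Λ_k = ℝ[εᵢ]/(εᵢ²)`
(`Summit.Parity.BatemanHorn.Theorems.TypeIMainTerm.aFun`), so that the tree's rate machinery applies.

* `kernelSum_coeff_prod_lin` — `[ε_T] ∏ᵢ (aᵢ + bᵢ εᵢ) = (∏_{i∈T} bᵢ)(∏_{i∉T} aᵢ)`
  (`SAlg.coeff_mul_prod_lin` with `x = 1`);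
* `kernelSum_coeff_cWeight` — `[ε_{univ∖S}] cWeight f d = G(d) (∏ᵢ μ(dᵢ)) ∏_{i∉S} log dᵢ`;
* `kernelSum_count_div_prod` — `#{n < ∏ dᵢ : dᵢ ∣ fᵢ(n) ∀ i}/∏ dᵢ = ρ(d)/lcm d = G(d)`
  (the solution set is `lcm d`-periodic, `card_filter_Ico_mul_sysPred`, and `lcm d ∣ ∏ dᵢ`);
* `stub_kernel_sum_eq` — regroup the box by `m = ∏ dᵢ` (`sum_box_filter_eq_sum_Ioc`) and sum.

Registered stub of the lead's skeleton `Summits/Parity/BatemanHorn/Cruxes/PolyMobiusTail/Lines/Sketch.lean`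
(namespace `Summit.Parity.BatemanHorn.Cruxes.PolyMobiusTail.NaturalForm`); the statement of
`stub_kernel_sum_eq` below is the registered signature VERBATIM and must not be edited. [folklore]
-/

open scoped BigOperators
open Filter Finset Polynomial Asymptotics

namespace Summit.Parity.BatemanHorn.Theorems.PolyMobiusTail.NaturalForm

open Literature.NumberTheory.Sieve
open Summit.Parity.BatemanHorn.Theorems.TypeIMainTerm

/-- The `T`-component of `∏ᵢ (aᵢ + bᵢ εᵢ) ∈ Λ_k` is `(∏_{i∈T} bᵢ)(∏_{i∉T} aᵢ)`. [folklore] -/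
theorem kernelSum_coeff_prod_lin {k : ℕ} (a b : Fin k → ℝ) (T : Finset (Fin k)) :
    SAlg.coeff (∏ i, SAlg.lin i (a i) (b i)) T = (∏ i ∈ T, b i) * ∏ i ∈ Finset.univ \ T, a i := by
  have h := SAlg.coeff_mul_prod_lin (1 : SAlg k) a b Finset.univ T
  rw [one_mul, Finset.univ_inter] at h
  rw [h, Finset.sum_eq_single T]
  · rw [Finset.sdiff_self, SAlg.coeff_one, if_pos rfl, mul_one]
  · intro J hJ hJT
    rw [SAlg.coeff_one, if_neg, mul_zero]
    intro h0
    exact hJT (Finset.Subset.antisymm (Finset.mem_powerset.mp hJ)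
      (Finset.sdiff_eq_empty_iff_subset.mp h0))
  · intro h
    exact absurd (Finset.mem_powerset.mpr Finset.Subset.rfl) h

/-- The `(univ ∖ S)`-component of `cWeight f d = G(d) ∏ᵢ (μ(dᵢ) + εᵢ μ(dᵢ) log dᵢ)` is
`G(d) · (∏ᵢ μ(dᵢ)) · ∏_{i∉S} log dᵢ`. [folklore] -/
theorem kernelSum_coeff_cWeight {k : ℕ} (f : Fin k → ℤ[X]) (d : Fin k → ℕ) (S : Finset (Fin k)) :
    SAlg.coeff (cWeight f d) (Finset.univ \ S) =
      sysDensity f d * ((∏ i, (ArithmeticFunction.moebius (d i) : ℝ)) *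
        ∏ i ∈ Finset.univ \ S, Real.log (d i)) := by
  unfold cWeight moebLin
  rw [SAlg.coeff_smul, kernelSum_coeff_prod_lin, Finset.sdiff_sdiff_eq_self (Finset.subset_univ S),
    Finset.prod_mul_distrib,
    ← Finset.prod_sdiff (Finset.subset_univ S) (f := fun i => (ArithmeticFunction.moebius (d i) : ℝ))]
  ring

/-- Periodicity count: if all `dᵢ ≥ 1` then `#{n < ∏ dᵢ : dᵢ ∣ fᵢ(n) ∀ i} / ∏ dᵢ = ρ(d)/lcm d = G(d)`
(the solution set is `lcm d`-periodic and `∏ dᵢ = q · lcm d`). [folklore] -/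
theorem kernelSum_count_div_prod {k : ℕ} (f : Fin k → ℤ[X]) {d : Fin k → ℕ} (hd : ∀ i, 0 < d i) :
    (((Finset.range (∏ i, d i)).filter
        (fun n : ℕ => ∀ i, ((d i : ℕ) : ℤ) ∣ (f i).eval (n : ℤ))).card : ℝ) / ∏ i, (d i : ℝ) =
      sysDensity f d := by
  obtain ⟨q, hqL⟩ : ∃ q, q * tupleLcm d = ∏ i, d i := ⟨_, Nat.div_mul_cancel (tupleLcm_dvd_prod d)⟩
  have hL : 0 < tupleLcm d := tupleLcm_pos hd
  have hprod : 0 < ∏ i, d i := Finset.prod_pos fun i _ => hd i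
  have hq0 : q ≠ 0 := by
    rintro rfl
    rw [zero_mul] at hqL
    exact hprod.ne' hqL.symm
  have hcount : ((Finset.range (∏ i, d i)).filter
      (fun n : ℕ => ∀ i, ((d i : ℕ) : ℤ) ∣ (f i).eval (n : ℤ))).card = q * sysCount f d := by
    have h := card_filter_Ico_mul_sysPred f d 0 q
    rw [zero_add, hqL, ← Finset.range_eq_Ico] at h
    exact h
  have hcast : ∏ i, (d i : ℝ) = ((q * tupleLcm d : ℕ) : ℝ) := by rw [hqL, Nat.cast_prod]
  have hq' : (q : ℝ) ≠ 0 := by exact_mod_cast hq0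
  rw [hcount, hcast, sysDensity, Nat.cast_mul, Nat.cast_mul, mul_div_mul_left _ _ hq']

/-- **Stub `stub_kernel_sum_eq`.** The kernel sum over the box `[1,⌊y⌋]^k ∩ {∏ dᵢ ≤ y}` with weight
`(∏ μ(dᵢ)) (∏_{i∉S} log dᵢ) · #{n < ∏ dᵢ : dᵢ ∣ fᵢ(n) ∀ i}/∏ dᵢ` is the partial sum of the
`[ε_{univ∖S}]`-component of `𝒶(m) = Σ_{d₁⋯d_k = m} G(d) ∏ᵢ (μ(dᵢ) + εᵢ μ(dᵢ) log dᵢ)`: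
regroup by `m = ∏ dᵢ` (`sum_box_filter_eq_sum_Ioc`), then `kernelSum_count_div_prod` and
`kernelSum_coeff_cWeight` termwise. [folklore] -/
theorem stub_kernel_sum_eq : ∀ (k : ℕ) (f : Fin k → ℤ[X]) (S : Finset (Fin k)) (y : ℝ), 0 ≤ y →
    (∑ d ∈ Fintype.piFinset (fun _ : Fin k => Finset.Icc 1 ⌊y⌋₊),
      if ∏ i, (d i : ℝ) ≤ y then
        (∏ i, (ArithmeticFunction.moebius (d i) : ℝ)) * (∏ i ∈ Finset.univ \ S, Real.log (d i)) *
          ((((Finset.range (∏ i, d i)).filter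
              (fun n : ℕ => ∀ i, ((d i : ℕ) : ℤ) ∣ (f i).eval (n : ℤ))).card : ℝ) / ∏ i, (d i : ℝ))
      else 0)
    = ∑ m ∈ Finset.Ioc 0 ⌊y⌋₊, Summit.Parity.BatemanHorn.Theorems.TypeIMainTerm.SAlg.coeff (Summit.Parity.BatemanHorn.Theorems.TypeIMainTerm.aFun f m) (Finset.univ \ S) := by
  intro k f S y hy
  rw [← Finset.sum_filter, sum_box_filter_eq_sum_Ioc _ hy]
  refine Finset.sum_congr rfl fun m _ => ?_
  rw [aFun_apply, SAlg.coeff_finset_sum]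
  refine Finset.sum_congr rfl fun d hd => ?_
  have hd0 : ∀ i, 0 < d i := fun i => Nat.pos_of_ne_zero (Nat.ne_zero_of_mem_finMulAntidiag hd i)
  rw [kernelSum_count_div_prod f hd0, kernelSum_coeff_cWeight]
  ring

end Summit.Parity.BatemanHorn.Theorems.PolyMobiusTail.NaturalForm
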